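import Mathlib

/-!
# `SL_n(F)` lies in every subgroup of `GL_n(F)` containing all commutators

Helper for stub D₂ `stub_deckUnitaryCommutatorGeneration` of the crux `PowersHodgeOfDeckCommutators`
(stmt-HodgeConjecture-19545, route `CyclicUnitaryPowers`, line `unitary-kunneth-fft` v5, lane 2), step (c) of the
D₂b plan (HOME/HANDOFF § hodge-nonav-prover-Bx): the purely group-theoretic fact that over a field `F` with
`(2 : F) ≠ 0`, every matrix of determinant `1` is a product of commutators of invertible matrices — in the form
the eigenblock argument consumes: **`toGL_mem_of_commutators`** — if a subgroup `S ≤ GL ι F` contains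
`a b a⁻¹ b⁻¹` for all `a, b ∈ GL ι F`, then it contains the image of `SL ι F`.

Proof: Mathlib's `Matrix.SpecialLinearGroup.diagonal_transvection_induction'` reduces to transvections and to
the two-entry diagonal elements `diag2n hij c`; a transvection `1 + c E_{ij}` is the commutator of the diagonal
matrix `diag(…, 2, …)` (entry `2` at `i`) with the transvection `1 + c E_{ij}` itself
(`diag(d) (1 + c E_{ij}) diag(d)⁻¹ = 1 + (d_i d_j⁻¹ c) E_{ij}`), and `diag2n hij c` is the commutator of
`diag(…, c, …)` (entry `c` at `i`) with the permutation matrix of the transposition `(i j)`.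
-/

noncomputable section

open Matrix
open scoped MatrixGroups

namespace Summit.HodgeConjecture.HodgeConjecture.Theorems.CyclicUnitaryPowersSLCommutators

variable {F : Type*} [Field F] {ι : Type*} [Fintype ι] [DecidableEq ι]

/-! ### §1 Diagonal units and transposition units in `GL` -/

/-- The diagonal matrix with entry `c` at `i` and `1` elsewhere. [folklore] -/
def diagAt (i : ι) (c : F) : Matrix ι ι F := diagonal (Function.update 1 i c)

/-- `diagAt i c * diagAt i c⁻¹ = 1` for `c ≠ 0`. [folklore] -/
theorem diagAt_mul_diagAt_inv (i : ι) {c : F} (hc : c ≠ 0) : diagAt i c * diagAt i c⁻¹ = 1 := by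
  rw [diagAt, diagAt, diagonal_mul_diagonal, ← diagonal_one]
  congr 1
  funext k
  by_cases hk : k = i
  · subst hk; simp [hc]
  · simp [hk]

/-- The diagonal unit with entry `c ≠ 0` at `i`. [folklore] -/
def diagUnit (i : ι) {c : F} (hc : c ≠ 0) : GL ι F :=
  ⟨diagAt i c, diagAt i c⁻¹, diagAt_mul_diagAt_inv i hc,
    by simpa only [inv_inv] using diagAt_mul_diagAt_inv i (inv_ne_zero hc)⟩

/-- Coercion of the diagonal unit. [folklore] -/
@[simp] theorem coe_diagUnit (i : ι) {c : F} (hc : c ≠ 0) : ((diagUnit i hc : GL ι F) : Matrix ι ι F) = diagAt i c :=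
  rfl

/-- Coercion of the inverse of the diagonal unit. [folklore] -/
@[simp] theorem coe_diagUnit_inv (i : ι) {c : F} (hc : c ≠ 0) :
    ((diagUnit i hc)⁻¹ : GL ι F) = (diagAt i c⁻¹ : Matrix ι ι F) :=
  rfl

/-- The permutation matrix of the transposition `(i j)` squares to `1`. [folklore] -/
theorem swapMatrix_mul_self (i j : ι) :
    (Equiv.swap i j).permMatrix F * (Equiv.swap i j).permMatrix F = 1 := by
  rw [← permMatrix_mul, Equiv.swap_mul_self, permMatrix_one]

/-- The transposition unit. [folklore] -/
def swapUnit (i j : ι) : GL ι F :=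
  ⟨(Equiv.swap i j).permMatrix F, (Equiv.swap i j).permMatrix F, swapMatrix_mul_self i j, swapMatrix_mul_self i j⟩

/-- Coercion of the transposition unit. [folklore] -/
@[simp] theorem coe_swapUnit (i j : ι) : ((swapUnit i j : GL ι F) : Matrix ι ι F) = (Equiv.swap i j).permMatrix F :=
  rfl

/-- Coercion of the inverse of the transposition unit. [folklore] -/
@[simp] theorem coe_swapUnit_inv (i j : ι) :
    ((swapUnit i j : GL ι F)⁻¹ : GL ι F) = ((Equiv.swap i j).permMatrix F : Matrix ι ι F) :=
  rfl

/-- Conjugating a diagonal matrix by the transposition matrix permutes the entries. [folklore] -/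
theorem swapMatrix_mul_diagonal_mul_swapMatrix (i j : ι) (d : ι → F) :
    (Equiv.swap i j).permMatrix F * diagonal d * (Equiv.swap i j).permMatrix F = diagonal (d ∘ Equiv.swap i j) := by
  rw [Equiv.Perm.permMatrix, PEquiv.toMatrix_toPEquiv_mul, PEquiv.mul_toMatrix_toPEquiv, Equiv.symm_swap,
    submatrix_submatrix, Function.id_comp, Function.comp_id, submatrix_diagonal_equiv]

/-! ### §2 Transvections and two-entry diagonals are commutators -/

/-- `diag(d) (c E_{ij}) diag(e) = (d_i c e_j) E_{ij}`. [folklore] -/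
theorem diagonal_mul_single_mul_diagonal (d e : ι → F) (i j : ι) (c : F) :
    diagonal d * single i j c * diagonal e = single i j (d i * c * e j) := by
  ext a b
  rw [mul_diagonal, diagonal_mul, single_apply, single_apply]
  split_ifs with h
  · obtain ⟨rfl, rfl⟩ := h; rfl
  · rw [mul_zero, zero_mul]

/-- `diagAt i a * transvection i j c * diagAt i a⁻¹ = transvection i j (a * c)` for `i ≠ j`, `a ≠ 0`. [folklore] -/
theorem diagAt_mul_transvection_mul (i j : ι) (hij : i ≠ j) {a : F} (ha : a ≠ 0) (c : F) :
    diagAt i a * transvection i j c * diagAt i a⁻¹ = transvection i j (a * c) := by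
  rw [transvection, transvection, Matrix.mul_add, Matrix.add_mul, Matrix.mul_one, diagAt_mul_diagAt_inv i ha]
  congr 1
  rw [diagAt, diagAt, diagonal_mul_single_mul_diagonal, Function.update_self,
    Function.update_of_ne (Ne.symm hij), Pi.one_apply, mul_one]

/-- **A transvection is a commutator in `GL`**: `[diagAt i 2, T_{ij}(c)] = T_{ij}(c)` (`2 ≠ 0`).
[folklore] -/
theorem toGL_transvection_eq_commutator (h2 : (2 : F) ≠ 0) {i j : ι} (hij : i ≠ j) (c : F) :
    SpecialLinearGroup.toGL (SpecialLinearGroup.transvection hij c) =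
      diagUnit i h2 * SpecialLinearGroup.toGL (SpecialLinearGroup.transvection hij c) * (diagUnit i h2)⁻¹ *
        (SpecialLinearGroup.toGL (SpecialLinearGroup.transvection hij c))⁻¹ := by
  rw [eq_mul_inv_iff_mul_eq]
  apply Units.ext
  simp only [Units.val_mul, SpecialLinearGroup.coe_GL_coe_matrix, coe_diagUnit, coe_diagUnit_inv]
  change transvection i j c * transvection i j c = diagAt i 2 * transvection i j c * diagAt i 2⁻¹
  rw [diagAt_mul_transvection_mul i j hij h2, transvection_mul_transvection_same (i := i) (j := j) hij c c, two_mul]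

/-- **A two-entry diagonal `diag2n` is a commutator in `GL`**: `[diagAt i c, swap(i j)] = diag2n hij c`.
[folklore] -/
theorem toGL_diag2n_eq_commutator {i j : ι} (hij : i ≠ j) {c : F} (hc : c ≠ 0) :
    SpecialLinearGroup.toGL (SpecialLinearGroup.diag2n hij c hc) =
      diagUnit i hc * swapUnit i j * (diagUnit i hc)⁻¹ * (swapUnit i j)⁻¹ := by
  apply Units.ext
  simp only [Units.val_mul, SpecialLinearGroup.coe_GL_coe_matrix, coe_diagUnit, coe_diagUnit_inv, coe_swapUnit,
    coe_swapUnit_inv]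
  rw [SpecialLinearGroup.diag2n_coe, Matrix.mul_assoc (diagAt i c) _ (diagAt i c⁻¹),
    Matrix.mul_assoc (diagAt i c) _ ((Equiv.swap i j).permMatrix F),
    show diagAt i c⁻¹ = diagonal (Function.update (1 : ι → F) i c⁻¹) from rfl,
    swapMatrix_mul_diagonal_mul_swapMatrix, diagAt, diagonal_mul_diagonal]
  congr 1
  funext k
  simp only [Function.comp_apply]
  by_cases hki : k = i
  · subst hki
    rw [Function.update_self, Equiv.swap_apply_left, Function.update_of_ne (Ne.symm hij), Pi.one_apply, mul_one,
      if_pos rfl]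
  · rw [Function.update_of_ne hki, Pi.one_apply, one_mul, if_neg hki]
    by_cases hkj : k = j
    · subst hkj
      rw [Equiv.swap_apply_right, Function.update_self, if_pos rfl]
    · rw [Equiv.swap_apply_of_ne_of_ne hki hkj, Function.update_of_ne hki, Pi.one_apply, if_neg hkj]

/-! ### §3 The theorem -/

/-- **`SL ι F` lies in every subgroup of `GL ι F` containing all commutators** (`(2 : F) ≠ 0`).
[folklore] -/
theorem toGL_mem_of_commutators (h2 : (2 : F) ≠ 0) (S : Subgroup (GL ι F))
    (hS : ∀ a b : GL ι F, a * b * a⁻¹ * b⁻¹ ∈ S) (M : SpecialLinearGroup ι F) :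
    SpecialLinearGroup.toGL M ∈ S := by
  rcases subsingleton_or_nontrivial ι with hι | hι
  · have hM : M = 1 := Subsingleton.elim _ _
    rw [hM, map_one]
    exact S.one_mem
  · refine SpecialLinearGroup.diagonal_transvection_induction' (fun M => SpecialLinearGroup.toGL M ∈ S) M
      (fun i j hij c hc => ?_) (fun i j hij a => ?_) (fun A B hA hB => ?_)
    · rw [toGL_diag2n_eq_commutator hij hc]
      exact hS _ _
    · rw [toGL_transvection_eq_commutator h2 hij a]
      exact hS _ _
    · rw [map_mul]
      exact S.mul_mem hA hB

end Summit.HodgeConjecture.HodgeConjecture.Theorems.CyclicUnitaryPowersSLCommutators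

end
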